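import Mathlib.RingTheory.Grassmannian
import Mathlib.RingTheory.LocalProperties.Submodule
import Mathlib.RingTheory.LocalProperties.Projective
import Mathlib.RingTheory.LocalProperties.FinitePresentation
import Mathlib.RingTheory.Localization.Finiteness
import Mathlib.RingTheory.Flat.Localization
import Mathlib.RingTheory.Flat.EquationalCriterion
import Mathlib.RingTheory.Spectrum.Prime.FreeLocus
import Mathlib.Algebra.Module.LocalizedModule.Submodule
import HarnessLib

/-!
# Zariski gluing of submodules along a finite open cover of `Spec R` (towards the sheaf property of the Grassmannian)

Topic `AlgebraicGeometry/Motives`; namespace `Literature.AlgebraicGeometry.Motives.Grassmannian`.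
THEOREMS ONLY (no definition, no named fact, no instance, no `sorry`); Mathlib-only imports.

[Stacks 00EO] / [GortzWedhorn2020, Thm. 7.12 with Cor. 7.17]: quasi-coherent subsheaves of a quasi-coherent sheaf on
`Spec R` glue along a cover by basic opens `D(fᵢ)`, `(f₁, …, fₙ) = R`.  In module language (the form the GRASSMANNIAN
FUNCTOR `Module.Grassmannian.functor` needs for its Zariski-sheaf property, [GortzWedhorn2020, (8.4) and (8.6)];
Grothendieck–Dieudonné, EGA I (Springer ed.) 9.7.4): let `M` be an `R`-module, `gᵢ : M → Mᵢ` localizations of `M` away from `fᵢ`, and `Mᵢ → Mᵢⱼ ← Mⱼ` localizations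
away from `fⱼ` resp. `fᵢ` over `M` (the double overlaps `D(fᵢfⱼ)`).  Mathlib proves the SEPARATION half
(`Submodule.eq_of_isLocalized'_span`: a submodule is determined by its localizations).  This file proves the GLUING half:

* §1 `smul_pow_mem_comap_of_localized₀_eq` — transport across one overlap: if `x ∈ Nᵣ` and the localizations of `Nᵣ`
  and `Nⱼ` agree in `Mᵣⱼ`, then `fᵣ^e • m ∈ gⱼ⁻¹(Nⱼ)` for some `e`, for any `m` with `gᵣ m = s • x`;
* §2 **`localized'_iInf_comap_eq`** — for a FINITE cover and a compatible family of `Rᵢ`-submodules `Nᵢ ≤ Mᵢ`, the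
  submodule `N₀ := ⨅ᵢ gᵢ⁻¹(Nᵢ)` of `M` localizes to `Nᵢ` at every `i`; **`existsUnique_localized'_eq`** — hence there is
  EXACTLY ONE `N₀ ≤ M` with these localizations (uniqueness = Mathlib's separation).

* §3 **`finite_projective_rankAtStalk_quotient_of_localized'_eq`** — if the `Mᵢ ⧸ Nᵢ` are finite projective of constant
  rank `k` over `Rᵢ` then so is `M ⧸ N₀` over `R` (Zariski-locality of finiteness, finite presentation and flatness, all
  Mathlib; projective = flat + finitely presented), i.e. the gluing stays inside `Module.Grassmannian`
  ([GortzWedhorn2020, (8.4) and (8.6)]: the Grassmannian functor is a Zariski sheaf).  Cell `hodgecm-mathlib` (D-0151), F-DAG first hand (h4) «Grassmannian as a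
scheme» (B-p21 (g15) author, B-p18 (g17) partner: charts), count-neutral Mathlib-side capital.  Nothing here is about HC;
HC_CM is proved only modulo the 7 printed citations until rung 0 closes.

## References
* [StacksProject] The Stacks project, Tag 00EO (gluing modules / the sheaf `M̃` on standard opens) and Tag 01I8.
* [GortzWedhorn2020] U. Görtz, T. Wedhorn, *Algebraic Geometry I*, 2nd ed. (2020), Thm. 7.12 (p. 185) with Cor. 7.17 (p. 188)
  (quasi-coherent modules on standard opens), (8.4) (pp. 213–215) and (8.6) (p. 217) (the Grassmannian functor is a Zariski sheaf).
-/

namespace Literature.AlgebraicGeometry.Motives.Grassmannian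

open IsLocalizedModule

universe u v w

variable {R : Type*} [CommRing R] {M : Type*} [AddCommGroup M] [Module R M]
  (s : Set R)
  (Rₚ : s → Type*) [∀ i, CommRing (Rₚ i)] [∀ i, Algebra R (Rₚ i)] [∀ i : s, IsLocalization.Away (i : R) (Rₚ i)]
  (Mₚ : s → Type*) [∀ i, AddCommGroup (Mₚ i)] [∀ i, Module R (Mₚ i)] [∀ i, Module (Rₚ i) (Mₚ i)]
  [∀ i, IsScalarTower R (Rₚ i) (Mₚ i)]
  (g : ∀ i : s, M →ₗ[R] Mₚ i) [∀ i : s, IsLocalizedModule (.powers (i : R)) (g i)]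
  (Mₚ₂ : s → s → Type*) [∀ i j, AddCommGroup (Mₚ₂ i j)] [∀ i j, Module R (Mₚ₂ i j)]
  (l : ∀ i j : s, Mₚ i →ₗ[R] Mₚ₂ i j) [∀ i j : s, IsLocalizedModule (.powers (j : R)) (l i j)]
  (r : ∀ i j : s, Mₚ j →ₗ[R] Mₚ₂ i j) [∀ i j : s, IsLocalizedModule (.powers (i : R)) (r i j)]

/-! ## §1 Transport of membership across one overlap `D(fᵣ fⱼ)` -/

omit [∀ i : s, IsLocalizedModule (.powers (i : R)) (g i)] in
/-- **Transport across an overlap.**  Let `gᵣ : M → Mᵣ`, `gⱼ : M → Mⱼ` be localizations away from `fᵣ`, `fⱼ`,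
`l : Mᵣ → Mᵣⱼ` a localization away from `fⱼ` and `r : Mⱼ → Mᵣⱼ` one away from `fᵣ` with `l ∘ gᵣ = r ∘ gⱼ`, and let
`Nᵣ ≤ Mᵣ`, `Nⱼ ≤ Mⱼ` have the SAME localization in `Mᵣⱼ`.  If `gᵣ m ∈ Nᵣ` then `fᵣ^e • m ∈ gⱼ⁻¹(Nⱼ)` for some `e`
(chase `r (gⱼ m) = l (gᵣ m)` into the common localization, clear the `fᵣ`-denominator with ★ `IsLocalizedModule.exists_of_eq`).
[cite: StacksProject, Tag 00EO] [cite: GortzWedhorn2020, Thm. 7.12 (p. 185) with Cor. 7.17 (p. 188)] -/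
theorem exists_pow_smul_mem_comap_of_localized₀_eq (rr j : s)
    (hlr : l rr j ∘ₗ g rr = r rr j ∘ₗ g j)
    (Nr : Submodule R (Mₚ rr)) (Nj : Submodule R (Mₚ j))
    (hN : Nr.localized₀ (.powers (j : R)) (l rr j) = Nj.localized₀ (.powers (rr : R)) (r rr j))
    {m : M} (hm : g rr m ∈ Nr) :
    ∃ e : ℕ, ((rr : R) ^ e) • m ∈ Nj.comap (g j) := by
  -- `l (gᵣ m)` lies in the localization of `Nᵣ`, hence in that of `Nⱼ`
  have h1 : l rr j (g rr m) ∈ Nj.localized₀ (.powers (rr : R)) (r rr j) := by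
    rw [← hN]
    exact ⟨g rr m, hm, 1, by rw [IsLocalizedModule.mk'_one]⟩
  obtain ⟨n, hn, t, ht⟩ := h1
  -- `r (gⱼ m) = l (gᵣ m) = t⁻¹ • r n`, so `r (t • gⱼ m) = r n`
  have h2 : r rr j (t • g j m) = r rr j n := by
    rw [LinearMap.map_smul_of_tower, ← LinearMap.comp_apply, ← hlr, LinearMap.comp_apply, ← ht,
      IsLocalizedModule.mk'_cancel']
  -- clear the denominator: `c • t • gⱼ m = c • n ∈ Nⱼ`
  obtain ⟨c, hc⟩ := IsLocalizedModule.exists_of_eq (S := .powers (rr : R)) (f := r rr j) h2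
  obtain ⟨a, ha⟩ := (Submonoid.mem_powers_iff _ _).1 c.2
  obtain ⟨b, hb⟩ := (Submonoid.mem_powers_iff _ _).1 t.2
  refine ⟨a + b, ?_⟩
  rw [Submodule.mem_comap, LinearMap.map_smul_of_tower, pow_add, mul_smul, hb, ha]
  change (c : R) • (t : R) • g j m ∈ Nj
  have hc' : (c : R) • (t : R) • g j m = (c : R) • n := by
    simpa only [Submonoid.smul_def] using hc
  rw [hc']
  exact Nj.smul_mem _ hn

/-! ## §2 Gluing along a finite cover -/

section Finite

variable [Finite s] (hf : Ideal.span s = ⊤)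

/-- Monotonicity of the «some power of `a` multiplies `m` into `N`» condition. [folklore] -/
private theorem pow_smul_mem_of_le {N : Submodule R M} {a : R} {m : M} {e e' : ℕ} (h : a ^ e • m ∈ N) (hle : e ≤ e') :
    a ^ e' • m ∈ N := by
  obtain ⟨d, rfl⟩ := Nat.exists_eq_add_of_le hle
  rw [add_comm, pow_add, mul_smul]
  exact N.smul_mem _ h

/-- **GLUING OF SUBMODULES ALONG A FINITE ZARISKI COVER.**  Let `(fᵢ)` be finitely many elements generating the unit
ideal of `R`, `gᵢ : M → Mᵢ` localizations away from `fᵢ`, `lᵢⱼ : Mᵢ → Mᵢⱼ`, `rᵢⱼ : Mⱼ → Mᵢⱼ` localizations away from `fⱼ`,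
`fᵢ` with `lᵢⱼ ∘ gᵢ = rᵢⱼ ∘ gⱼ`, and `Nᵢ ≤ Mᵢ` a family of `Rᵢ`-submodules COMPATIBLE on overlaps (the localizations of `Nᵢ`
and `Nⱼ` in `Mᵢⱼ` agree).  Then `N₀ := ⨅ᵢ gᵢ⁻¹(Nᵢ)` localizes to `Nᵢ` away from every `fᵢ` (this half does not even use
that the `fᵢ` generate the unit ideal).
Proof: `⊆` is clear (`Nᵢ` is an `Rᵢ`-submodule); for `⊇`, write `x ∈ Nᵢ` as `s⁻¹ gᵢ m`, transport `gᵢ m ∈ Nᵢ` across each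
overlap (§1) to `fᵢ^{eⱼ} • m ∈ gⱼ⁻¹(Nⱼ)`, take `E = max eⱼ` (finite cover), and `x = (s fᵢ^E)⁻¹ gᵢ(fᵢ^E • m)`.
[cite: StacksProject, Tag 00EO] [cite: GortzWedhorn2020, Thm. 7.12 (p. 185) with Cor. 7.17 (p. 188), (8.4) (pp. 213–215) and (8.6) (p. 217)] -/
theorem localized'_iInf_comap_eq (hlr : ∀ i j, l i j ∘ₗ g i = r i j ∘ₗ g j)
    (N : ∀ i, Submodule (Rₚ i) (Mₚ i))
    (hN : ∀ i j : s, ((N i).restrictScalars R).localized₀ (.powers (j : R)) (l i j) =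
      ((N j).restrictScalars R).localized₀ (.powers (i : R)) (r i j))
    (i : s) :
    (⨅ j, ((N j).restrictScalars R).comap (g j)).localized' (Rₚ i) (.powers (i : R)) (g i) = N i := by
  classical
  apply le_antisymm
  · -- `⊆`: `s⁻¹ • gᵢ m ∈ Nᵢ` when `gᵢ m ∈ Nᵢ`
    rintro x ⟨m, hm, t, rfl⟩
    have hmi : g i m ∈ N i := (Submodule.mem_iInf _).1 hm i
    -- `mk' m t = (1/t) • gᵢ m`
    have h1 : IsLocalizedModule.mk' (g i) m t =
        IsLocalization.mk' (Rₚ i) (1 : R) t • IsLocalizedModule.mk' (g i) m (1 : Submonoid.powers (i : R)) := by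
      rw [IsLocalizedModule.mk'_smul_mk', one_smul, mul_one]
    rw [h1, IsLocalizedModule.mk'_one]
    exact (N i).smul_mem _ hmi
  · -- `⊇`
    intro x hx
    obtain ⟨⟨m, t⟩, hms⟩ := IsLocalizedModule.surj (.powers (i : R)) (g i) x
    change t • x = g i m at hms
    have hgm : g i m ∈ (N i).restrictScalars R := by
      rw [Submodule.restrictScalars_mem, ← hms]
      exact ((N i).restrictScalars R).smul_mem _ hx
    -- exponents across every overlap
    have hex : ∀ j, ∃ e : ℕ, ((i : R) ^ e) • m ∈ ((N j).restrictScalars R).comap (g j) := fun j =>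
      exists_pow_smul_mem_comap_of_localized₀_eq s Mₚ g Mₚ₂ l r i j (hlr i j) _ _ (hN i j) hgm
    choose e he using hex
    haveI : Fintype s := Fintype.ofFinite s
    set E : ℕ := Finset.univ.sup e with hE
    have hmem : ((i : R) ^ E) • m ∈ ⨅ j, ((N j).restrictScalars R).comap (g j) :=
      (Submodule.mem_iInf _).2 fun j => pow_smul_mem_of_le (he j) (Finset.le_sup (Finset.mem_univ j))
    -- `x = (t • fᵢ^E)⁻¹ • gᵢ (fᵢ^E • m)`
    refine ⟨((i : R) ^ E) • m, hmem, t * ⟨(i : R) ^ E, E, rfl⟩, ?_⟩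
    rw [IsLocalizedModule.mk'_eq_iff, LinearMap.map_smul_of_tower, ← hms]
    simp only [Submonoid.smul_def, Submonoid.coe_mul, smul_smul, mul_comm]

include hf in
/-- **A submodule with prescribed localizations IS the glued one**: if `N₁ ≤ M` localizes to `Nᵢ` away from every `fᵢ`
(finitely many `fᵢ` generating the unit ideal), then `N₁ = ⨅ᵢ gᵢ⁻¹(Nᵢ)`.  (`≤`: `gᵢ x ∈ Nᵢ`; `≥`: `gⱼ x ∈ Nⱼ = (N₁)ⱼ` gives
`fⱼ^{e} • x ∈ N₁` for every `j`, and the `fⱼ^{e}` generate the unit ideal — Mathlib `Ideal.span_pow_eq_top`.)  This is the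
SEPARATION half (Mathlib ★ `Submodule.eq_of_isLocalized'_span`) in the index-family form used here.
[cite: StacksProject, Tag 00EO] [cite: GortzWedhorn2020, Thm. 7.12 (p. 185) with Cor. 7.17 (p. 188)] -/
theorem eq_iInf_comap_of_localized'_eq (N : ∀ i, Submodule (Rₚ i) (Mₚ i)) (N₁ : Submodule R M)
    (hN₁ : ∀ i, N₁.localized' (Rₚ i) (.powers (i : R)) (g i) = N i) :
    N₁ = ⨅ j, ((N j).restrictScalars R).comap (g j) := by
  classical
  apply le_antisymm
  · refine le_iInf fun j => fun x hx => ?_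
    rw [Submodule.mem_comap, Submodule.restrictScalars_mem, ← hN₁ j]
    exact ⟨x, hx, 1, IsLocalizedModule.mk'_one _ _ _⟩
  · intro x hx
    -- for each `j`: `fⱼ^e • x ∈ N₁`
    have hex : ∀ j : s, ∃ e : ℕ, ((j : R) ^ e) • x ∈ N₁ := by
      intro j
      have hj : g j x ∈ N₁.localized' (Rₚ j) (.powers (j : R)) (g j) := by
        rw [hN₁ j]
        exact (Submodule.mem_iInf _).1 hx j
      obtain ⟨m, hm, t, ht⟩ := hj
      -- `t • gⱼ x = gⱼ m`, so `c • t • x = c • m ∈ N₁`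
      have h2 : g j ((t : R) • x) = g j m := by
        rw [LinearMap.map_smul_of_tower, ← ht, ← Submonoid.smul_def, IsLocalizedModule.mk'_cancel']
      obtain ⟨c, hc⟩ := IsLocalizedModule.exists_of_eq (S := .powers (j : R)) (f := g j) h2
      obtain ⟨a, ha⟩ := (Submonoid.mem_powers_iff _ _).1 c.2
      obtain ⟨b, hb⟩ := (Submonoid.mem_powers_iff _ _).1 t.2
      refine ⟨a + b, ?_⟩
      rw [pow_add, mul_smul, hb, ha]
      have hc' : (c : R) • (t : R) • x = (c : R) • m := by simpa only [Submonoid.smul_def] using hc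
      rw [hc']
      exact N₁.smul_mem _ hm
    choose e he using hex
    haveI : Fintype s := Fintype.ofFinite s
    set E : ℕ := Finset.univ.sup e with hE
    have hE' : ∀ j : s, ((j : R) ^ E) • x ∈ N₁ := fun j =>
      pow_smul_mem_of_le (he j) (Finset.le_sup (Finset.mem_univ j))
    -- the `fⱼ^E` generate the unit ideal
    have hspan : Ideal.span ((fun y => y ^ E) '' s) = ⊤ := Ideal.span_pow_eq_top _ hf E
    have h1 : (1 : R) ∈ Ideal.span ((fun y => y ^ E) '' s) := by rw [hspan]; trivial
    -- `x = 1 • x ∈ N₁` since `I • x ⊆ N₁` for the ideal `I = (fⱼ^E)ⱼ`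
    have key : ∀ y ∈ Ideal.span ((fun y => y ^ E) '' s), y • x ∈ N₁ := by
      intro y hy
      refine Submodule.span_induction ?_ ?_ ?_ ?_ hy
      · rintro _ ⟨a, ha, rfl⟩
        exact hE' ⟨a, ha⟩
      · rw [zero_smul]; exact N₁.zero_mem
      · intro a b _ _ ha hb
        rw [add_smul]; exact N₁.add_mem ha hb
      · intro a b _ hb
        rw [smul_eq_mul, mul_smul]; exact N₁.smul_mem _ hb
    simpa only [one_smul] using key 1 h1

include hf in
/-- **EXISTENCE AND UNIQUENESS OF THE GLUED SUBMODULE** along a finite Zariski cover: under the hypotheses of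
`localized'_iInf_comap_eq` there is exactly one submodule `N₀ ≤ M` whose localization away from `fᵢ` is `Nᵢ` for every `i`
(existence: `⨅ᵢ gᵢ⁻¹(Nᵢ)`; uniqueness: `eq_iInf_comap_of_localized'_eq`). [cite: StacksProject, Tag 00EO]
[cite: GortzWedhorn2020, Thm. 7.12 (p. 185) with Cor. 7.17 (p. 188)] -/
theorem existsUnique_localized'_eq (hlr : ∀ i j, l i j ∘ₗ g i = r i j ∘ₗ g j)
    (N : ∀ i, Submodule (Rₚ i) (Mₚ i))
    (hN : ∀ i j : s, ((N i).restrictScalars R).localized₀ (.powers (j : R)) (l i j) =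
      ((N j).restrictScalars R).localized₀ (.powers (i : R)) (r i j)) :
    ∃! N₀ : Submodule R M, ∀ i, N₀.localized' (Rₚ i) (.powers (i : R)) (g i) = N i :=
  ⟨⨅ j, ((N j).restrictScalars R).comap (g j), fun i => localized'_iInf_comap_eq s Rₚ Mₚ g Mₚ₂ l r hlr N hN i,
    fun N₁ hN₁ => eq_iInf_comap_of_localized'_eq s Rₚ Mₚ g hf N N₁ hN₁⟩

end Finite

/-! ## §3 The quotient by the glued submodule is finite, projective, of constant rank -/

section Quotient

variable (hf : Ideal.span s = ⊤)

include hf in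
/-- An element of `s` outside a given prime exists when `s` generates the unit ideal. [folklore] -/
private theorem exists_mem_not_mem_of_span_eq_top (p : PrimeSpectrum R) : ∃ i : s, (i : R) ∉ p.asIdeal := by
  by_contra! h
  have hle : Ideal.span s ≤ p.asIdeal := Ideal.span_le.2 fun a ha => h ⟨a, ha⟩
  rw [hf, top_le_iff] at hle
  exact p.2.ne_top hle

/-- **The quotient `M ⧸ N₁` localizes to `Mᵢ ⧸ Nᵢ`**: if `N₁` localizes to `Nᵢ` away from `fᵢ`, the canonical map
`M ⧸ N₁ → Mᵢ ⧸ Nᵢ` (★ `Submodule.toLocalizedQuotient'` followed by the identification `Mᵢ ⧸ (N₁)ᵢ = Mᵢ ⧸ Nᵢ`) is a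
localization away from `fᵢ`. [cite: StacksProject, Tag 00EO] -/
theorem isLocalizedModule_quotient (N : ∀ i, Submodule (Rₚ i) (Mₚ i)) (N₁ : Submodule R M) (i : s)
    (hN₁ : N₁.localized' (Rₚ i) (.powers (i : R)) (g i) = N i) :
    IsLocalizedModule (.powers (i : R))
      ((((N₁.localized' (Rₚ i) (.powers (i : R)) (g i)).quotEquivOfEq (N i) hN₁).restrictScalars R).toLinearMap ∘ₗ
        N₁.toLocalizedQuotient' (Rₚ i) (.powers (i : R)) (g i)) :=
  IsLocalizedModule.of_linearEquiv _ _ _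

include hf in
/-- **GLUING STAYS INSIDE THE GRASSMANNIAN.**  Let `s ⊆ R` generate the unit ideal, `gᵢ : M → Mᵢ` localizations away from
`i ∈ s`, and `N₁ ≤ M` a submodule localizing to `Nᵢ ≤ Mᵢ` for every `i`.  If every `Mᵢ ⧸ Nᵢ` is a finitely generated
projective `Rᵢ`-module of constant rank `k`, then `M ⧸ N₁` is a finitely generated projective `R`-module of constant rank `k`
(finiteness and finite presentation are Zariski-local ★ `Module.Finite/FinitePresentation.of_localizationSpan'`, flatness is
Zariski-local ★ `Module.flat_of_isLocalized_span` and projective = flat + finitely presented ★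
`Module.Flat.projective_of_finitePresentation`; the rank at `p ∈ D(fᵢ)` is read on `Mᵢ ⧸ Nᵢ` ★ `Module.rankAtStalk_isBaseChange`).
This is the statement that makes the Zariski gluing of §2 a gluing of `Module.Grassmannian` elements
([GortzWedhorn2020, (8.6)]: the Grassmannian functor is a Zariski sheaf). [cite: GortzWedhorn2020, (8.4) (pp. 213–215) and (8.6) (p. 217)]
[cite: StacksProject, Tag 00EO and Tag 00NX] -/
theorem finite_projective_rankAtStalk_quotient_of_localized'_eq (N : ∀ i, Submodule (Rₚ i) (Mₚ i))
    (N₁ : Submodule R M) (hN₁ : ∀ i, N₁.localized' (Rₚ i) (.powers (i : R)) (g i) = N i) (k : ℕ)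
    (hfin : ∀ i, Module.Finite (Rₚ i) (Mₚ i ⧸ N i)) (hproj : ∀ i, Module.Projective (Rₚ i) (Mₚ i ⧸ N i))
    (hrk : ∀ i p, Module.rankAtStalk (R := Rₚ i) (Mₚ i ⧸ N i) p = k) :
    Module.Finite R (M ⧸ N₁) ∧ Module.Projective R (M ⧸ N₁) ∧
      ∀ p, Module.rankAtStalk (R := R) (M ⧸ N₁) p = k := by
  -- the localization maps of the quotient
  let q : ∀ i : s, M ⧸ N₁ →ₗ[R] Mₚ i ⧸ N i := fun i =>
    (((N₁.localized' (Rₚ i) (.powers (i : R)) (g i)).quotEquivOfEq (N i) (hN₁ i)).restrictScalars R).toLinearMap ∘ₗ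
      N₁.toLocalizedQuotient' (Rₚ i) (.powers (i : R)) (g i)
  haveI hq : ∀ i : s, IsLocalizedModule (.powers (i : R)) (q i) := fun i =>
    isLocalizedModule_quotient s Rₚ Mₚ g N N₁ i (hN₁ i)
  -- finite, finitely presented
  haveI hF : Module.Finite R (M ⧸ N₁) := Module.Finite.of_localizationSpan' s hf (Rₚ := Rₚ) q hfin
  haveI hFP : Module.FinitePresentation R (M ⧸ N₁) :=
    Module.FinitePresentation.of_localizationSpan' s hf (Rₚ := Rₚ) q
      (fun i => Module.finitePresentation_of_projective (Rₚ i) (Mₚ i ⧸ N i))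
  -- flat (the pieces are projective over `Rᵢ`, and `Rᵢ` is flat over `R`), hence projective
  have hflat : ∀ i : s, Module.Flat R (Mₚ i ⧸ N i) := fun i =>
    haveI : Module.Flat R (Rₚ i) := IsLocalization.flat (Rₚ i) (.powers (i : R))
    Module.Flat.trans R (Rₚ i) (Mₚ i ⧸ N i)
  haveI : Module.Flat R (M ⧸ N₁) := Module.flat_of_isLocalized_span R (M ⧸ N₁) s hf (fun i => Mₚ i ⧸ N i) q hflat
  refine ⟨hF, Module.Flat.projective_of_finitePresentation, fun p => ?_⟩
  -- the rank at `p`: choose `i ∈ s` with `p ∈ D(fᵢ)` and read the rank on `Mᵢ ⧸ Nᵢ`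
  obtain ⟨i, hi⟩ := exists_mem_not_mem_of_span_eq_top s hf p
  have hp : p ∈ Set.range (PrimeSpectrum.comap (algebraMap R (Rₚ i))) := by
    rw [PrimeSpectrum.localization_away_comap_range (Rₚ i) (i : R)]
    exact hi
  obtain ⟨p', rfl⟩ := hp
  have hbc : IsBaseChange (Rₚ i) (q i) := (isLocalizedModule_iff_isBaseChange (.powers (i : R)) (Rₚ i) (q i)).1 (hq i)
  rw [← Module.rankAtStalk_isBaseChange hbc p']
  exact hrk i p'

end Quotient

end Literature.AlgebraicGeometry.Motives.Grassmannian
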